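import Summits.AtomisticToContinuum.HydrodynamicLimit.Theorems.AntiMazurCoboundariesCorrectorPressureDecayEquivalences
import Summits.AtomisticToContinuum.HydrodynamicLimit.Theorems.AntiMazurCoboundariesKineticWindowGronwallWindowSubadditivity
import Summits.AtomisticToContinuum.HydrodynamicLimit.Theorems.JParityClosureOddContactSymmetryGibbsInvariance
import Summits.AtomisticToContinuum.HydrodynamicLimit.Theorems.AntiMazurCoboundariesCorrectorPressureDecayWindowFunctional
import Literature.MathematicalPhysics.KineticTheory.HardSphereWindowPressureStatic
import Literature.MathematicalPhysics.KineticTheory.HardSphereTwoTimePressure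
import HarnessLib

/-!
# Common-window superposition of kinetic-window exponential moments (stub `stub_windowSuperposition`)

Crux `Summit.AtomisticToContinuum.HydrodynamicLimit.Theses.AntiMazurCoboundaries.CorrectorPressureDecay`
(stmt-AtomisticToContinuum-14135), line `birth` (velocity-parity sector split of the wall `KineticFluxLdDecay`),
registered stub `stub_windowSuperposition`, proved verbatim.

Fix `σ, a, θ > 0`, `u₀`, `N`, a hard-sphere flow `Φ` on `𝕋³` and the homogeneous global Gibbs law
`G_N = localGibbsLaw σ a u₀ θ N Φ` (a probability measure, carried by `Φ.good`, invariant under every `Φ_t`: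
`Theorems.measurePreserving_flow_localGibbsLaw_const`). For continuous `φ` (`|φ| ≤ 1`), continuous velocity
observables `G₁, G₂` with `|G₁|, |G₂| ≤ A` and `G₁ + G₂ = 2G`, write `F_j(z) = Σᵢ φ(xᵢ) G_j((vᵢ − u₀)/√θ)` and
`Λ_t(F) = ∫⁻ exp (t⁻¹ ∫₀ᵗ F(Φ_s z) ds) dG_N`. If `Λ_{τ₁ℓ}(F₁) ≤ K` and `Λ_{τ₂ℓ}(F₂) ≤ K` (`K ≥ 1`,
`ℓ = (N+1)^{-1/3}`), then for every common window `τ ≥ τ₁, τ₂`: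
`Λ_{τℓ}(F) ≤ K · exp (A (τ₁+τ₂)/(2τ) · (N+1))`.

PROOF (generic in the flow, `lintegral_exp_window_le_of_base`): write `T = m h + r`, `m = ⌊T/h⌋ ≥ 1`,
`0 ≤ r < h`. If `r = 0`, `Λ_T = Λ_{mh} ≤ Λ_h` (window subadditivity
`KineticWindowGronwallWindowSubadditivity.lintegral_exp_window_mul_le_of_aemeasurable`). Otherwise the two-window
Hölder bound `Λ_{mh+r} ≤ Λ_{mh}^{mh/T} Λ_r^{r/T}` (`lintegral_exp_window_add_le_of_aemeasurable`, invariance), with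
`Λ_{mh} ≤ Λ_h ≤ K`, `K^{mh/T} ≤ K` (`K ≥ 1`) and the STATIC bound `Λ_r ≤ e^{B}` (`|F| ≤ B` pointwise, `G_N` a
probability law), `e^{B r/T} ≤ e^{B h/T}`. Finally `F = (F₁ + F₂)/2`, so on good orbits the window functional of
`F` is the average of those of `F₁, F₂`, and Cauchy–Schwarz (`ENNReal.lintegral_mul_norm_pow_le`, exponents
`1/2, 1/2`) gives `Λ_T(F) ≤ Λ_T(F₁)^{1/2} Λ_T(F₂)^{1/2} ≤ K e^{B(h₁+h₂)/(2T)}`, `B = A(N+1)`, `h_j = τ_j ℓ`, `T = τℓ`.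
Measurability of the window functionals: `aemeasurable_window_of_modification` with the jointly measurable
piecewise flow (`measurable_piecewise_flow_torus`); interval integrability along good orbits:
`HardSphereFlow.intervalIntegrable_comp_flow_of_bounded`; `G_N(goodᶜ) = 0`: `ae_mem_good_localGibbsLaw`.

References: Kipnis–Landim (1999) Ch. 7 (subadditivity of window pressures); Olla–Varadhan–Yau, CMP 155 (1993) §3.
-/

noncomputable section

open MeasureTheory ProbabilityTheory
open scoped ENNReal

namespace Summit.AtomisticToContinuum.HydrodynamicLimit.Theorems.Birth

open Literature.MathematicalPhysics.KineticTheory (T3 V3 hsDiameter localGibbsLaw)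
open Literature.Analysis.FluidPDE (HardSphereFlow)
open Literature.Analysis.FluidPDE (Config Geometry)
open Summit.AtomisticToContinuum.HydrodynamicLimit.Theorems.KineticWindowGronwallWindowSubadditivity
  (lintegral_exp_window_mul_le_of_aemeasurable lintegral_exp_window_add_le_of_aemeasurable
    aemeasurable_window_of_modification ofReal_exp_mul_left)

section Generic

variable {d : Type*} [Fintype d] {X : Type*} [MeasureSpace X] [TopologicalSpace X] {Gm : Geometry d X}
  {ε : ℝ} {n : ℕ} (Φ : HardSphereFlow Gm ε n) (P : Measure (Config n d X))

/-- **Static bound.** For an observable `F` with `|F| ≤ B` pointwise, a probability law `P` and a window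
`r > 0`: `∫⁻ exp (r⁻¹ ∫₀ʳ F (Φ_s z) ds) dP ≤ e^{B}` (no measurability or goodness needed). [folklore] -/
private theorem lintegral_exp_window_le_static [IsProbabilityMeasure P] (F : Config n d X → ℝ) {B : ℝ}
    (hB : ∀ z, |F z| ≤ B) {r : ℝ} (hr : 0 < r) :
    ∫⁻ z, ENNReal.ofReal (Real.exp (r⁻¹ * ∫ s in (0 : ℝ)..r, F (Φ.flow s z))) ∂P ≤
      ENNReal.ofReal (Real.exp B) := by
  have hpt : ∀ z, ENNReal.ofReal (Real.exp (r⁻¹ * ∫ s in (0 : ℝ)..r, F (Φ.flow s z))) ≤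
      ENNReal.ofReal (Real.exp B) := fun z => by
    refine ENNReal.ofReal_le_ofReal (Real.exp_le_exp.mpr ?_)
    have h := intervalIntegral.norm_integral_le_of_norm_le_const (a := 0) (b := r)
      (f := fun s => F (Φ.flow s z)) (C := B) fun s _ => by
        rw [Real.norm_eq_abs]
        exact hB _
    rw [sub_zero, abs_of_pos hr, Real.norm_eq_abs] at h
    have h' := (le_abs_self _).trans h
    rw [inv_mul_le_iff₀ hr]
    linarith
  calc ∫⁻ z, ENNReal.ofReal (Real.exp (r⁻¹ * ∫ s in (0 : ℝ)..r, F (Φ.flow s z))) ∂P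
      ≤ ∫⁻ _z, ENNReal.ofReal (Real.exp B) ∂P := lintegral_mono hpt
    _ = ENNReal.ofReal (Real.exp B) := by rw [lintegral_const, measure_univ, mul_one]

/-- **From a base window to every longer window.** For a probability law `P` carried by `Φ.good` and
invariant under the flow, an observable `F` with `|F| ≤ B` (`0 ≤ B`), interval-integrable along good orbits,
with `P`-a.e. measurable window functionals: if `Λ_h ≤ K` with `K ≥ 1` and `0 < h ≤ T`, then
`Λ_T ≤ K · e^{B h/T}` — `T = m h + r`, subadditivity `Λ_{mh} ≤ Λ_h`, two-window Hölder, statics for the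
remainder window. [folklore] -/
private theorem lintegral_exp_window_le_of_base [IsProbabilityMeasure P] (hP : P Φ.goodᶜ = 0)
    (hinv : ∀ t : ℝ, MeasurePreserving (Φ.flow t) P P) (F : Config n d X → ℝ) {B : ℝ} (hB0 : 0 ≤ B)
    (hB : ∀ z, |F z| ≤ B)
    (hint : ∀ z ∈ Φ.good, ∀ a b : ℝ, IntervalIntegrable (fun s => F (Φ.flow s z)) volume a b)
    (hY : ∀ t : ℝ, AEMeasurable (fun z => ∫ s in (0 : ℝ)..t, F (Φ.flow s z)) P)
    {h T : ℝ} (hh : 0 < h) (hhT : h ≤ T) {K : ℝ≥0∞} (hK : 1 ≤ K)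
    (hbase : ∫⁻ z, ENNReal.ofReal (Real.exp (h⁻¹ * ∫ s in (0 : ℝ)..h, F (Φ.flow s z))) ∂P ≤ K) :
    ∫⁻ z, ENNReal.ofReal (Real.exp (T⁻¹ * ∫ s in (0 : ℝ)..T, F (Φ.flow s z))) ∂P ≤
      K * ENNReal.ofReal (Real.exp (B * (h / T))) := by
  have hT : 0 < T := hh.trans_le hhT
  have hexp1 : 1 ≤ ENNReal.ofReal (Real.exp (B * (h / T))) :=
    ENNReal.one_le_ofReal.mpr (Real.one_le_exp (mul_nonneg hB0 (div_nonneg hh.le hT.le)))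
  -- integer part of `T / h`
  obtain ⟨m, hm0, hmle, hlt⟩ : ∃ m : ℕ, 0 < m ∧ (m : ℝ) * h ≤ T ∧ T < (m : ℝ) * h + h := by
    have hTh : 1 ≤ T / h := (one_le_div hh).mpr hhT
    refine ⟨⌊T / h⌋₊, Nat.floor_pos.mpr hTh, ?_, ?_⟩
    · exact (le_div_iff₀ hh).mp (Nat.floor_le (zero_le_one.trans hTh))
    · have h1 := Nat.lt_floor_add_one (T / h)
      rw [div_lt_iff₀ hh] at h1
      linarith
  -- subadditivity: `Λ_{m h} ≤ Λ_h ≤ K`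
  have hmul : ∫⁻ z, ENNReal.ofReal (Real.exp (((m : ℝ) * h)⁻¹ *
      ∫ s in (0 : ℝ)..((m : ℝ) * h), F (Φ.flow s z))) ∂P ≤ K :=
    (lintegral_exp_window_mul_le_of_aemeasurable Φ P hP h (hinv h) F hint (hY h) m hm0).trans hbase
  -- the remainder window
  obtain ⟨r, hr0, hrh, hTeq⟩ : ∃ r : ℝ, 0 ≤ r ∧ r < h ∧ T = (m : ℝ) * h + r :=
    ⟨T - (m : ℝ) * h, by linarith, by linarith, by ring⟩
  subst hTeq
  rcases hr0.eq_or_lt with hr | hr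
  · -- `T` an exact multiple of `h`: no remainder
    subst hr
    rw [add_zero]
    exact hmul.trans (le_mul_of_one_le_right' (by rwa [add_zero] at hexp1))
  · have hmh : 0 < (m : ℝ) * h := mul_pos (Nat.cast_pos.mpr hm0) hh
    have key := lintegral_exp_window_add_le_of_aemeasurable Φ P hP hmh hr (hinv _) F hint (hY _) (hY r) 1
    simp only [one_mul] at key
    refine key.trans ?_
    have hp0 : 0 ≤ (m : ℝ) * h / ((m : ℝ) * h + r) := by positivity
    have hp1 : (m : ℝ) * h / ((m : ℝ) * h + r) ≤ 1 := by
      rw [div_le_one hT]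
      linarith
    have hq0 : 0 ≤ r / ((m : ℝ) * h + r) := by positivity
    have hqle : r / ((m : ℝ) * h + r) * B ≤ B * (h / ((m : ℝ) * h + r)) := by
      rw [mul_comm]
      exact mul_le_mul_of_nonneg_left (div_le_div_of_nonneg_right hrh.le hT.le) hB0
    refine mul_le_mul' ?_ ?_
    · calc (∫⁻ z, ENNReal.ofReal (Real.exp (((m : ℝ) * h)⁻¹ *
              ∫ s in (0 : ℝ)..((m : ℝ) * h), F (Φ.flow s z))) ∂P) ^ ((m : ℝ) * h / ((m : ℝ) * h + r))
          ≤ K ^ ((m : ℝ) * h / ((m : ℝ) * h + r)) := ENNReal.rpow_le_rpow hmul hp0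
        _ ≤ K ^ (1 : ℝ) := ENNReal.rpow_le_rpow_of_exponent_le hK hp1
        _ = K := ENNReal.rpow_one K
    · calc (∫⁻ z, ENNReal.ofReal (Real.exp (r⁻¹ * ∫ s in (0 : ℝ)..r, F (Φ.flow s z))) ∂P) ^
              (r / ((m : ℝ) * h + r))
          ≤ ENNReal.ofReal (Real.exp B) ^ (r / ((m : ℝ) * h + r)) :=
            ENNReal.rpow_le_rpow (lintegral_exp_window_le_static Φ P F hB hr) hq0
        _ = ENNReal.ofReal (Real.exp (r / ((m : ℝ) * h + r) * B)) := (ofReal_exp_mul_left _ _ hq0).symm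
        _ ≤ ENNReal.ofReal (Real.exp (B * (h / ((m : ℝ) * h + r)))) :=
            ENNReal.ofReal_le_ofReal (Real.exp_le_exp.mpr hqle)

/-- **Common-window superposition, generic form.** Under the frame of `lintegral_exp_window_le_of_base` for two
observables `F₁, F₂` (`|F_j| ≤ B`) with `F₁ + F₂ = 2F`: if `Λ_{h₁}(F₁) ≤ K` and `Λ_{h₂}(F₂) ≤ K` (`K ≥ 1`), then
for every `T ≥ h₁, h₂`, `Λ_T(F) ≤ K · e^{B (h₁+h₂)/(2T)}` (the previous lemma for each `j`, then Cauchy–Schwarz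
for `exp` of the average of the two window functionals). [folklore] -/
private theorem lintegral_exp_window_superposition [IsProbabilityMeasure P] (hP : P Φ.goodᶜ = 0)
    (hinv : ∀ t : ℝ, MeasurePreserving (Φ.flow t) P P) (F F₁ F₂ : Config n d X → ℝ) {B : ℝ}
    (hB0 : 0 ≤ B) (hB₁ : ∀ z, |F₁ z| ≤ B) (hB₂ : ∀ z, |F₂ z| ≤ B) (hF : ∀ z, F₁ z + F₂ z = 2 * F z)
    (hint₁ : ∀ z ∈ Φ.good, ∀ a b : ℝ, IntervalIntegrable (fun s => F₁ (Φ.flow s z)) volume a b)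
    (hint₂ : ∀ z ∈ Φ.good, ∀ a b : ℝ, IntervalIntegrable (fun s => F₂ (Φ.flow s z)) volume a b)
    (hY₁ : ∀ t : ℝ, AEMeasurable (fun z => ∫ s in (0 : ℝ)..t, F₁ (Φ.flow s z)) P)
    (hY₂ : ∀ t : ℝ, AEMeasurable (fun z => ∫ s in (0 : ℝ)..t, F₂ (Φ.flow s z)) P)
    {h₁ h₂ T : ℝ} (hh₁ : 0 < h₁) (hh₂ : 0 < h₂) (h₁T : h₁ ≤ T) (h₂T : h₂ ≤ T) {K : ℝ≥0∞} (hK : 1 ≤ K)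
    (hΛ₁ : ∫⁻ z, ENNReal.ofReal (Real.exp (h₁⁻¹ * ∫ s in (0 : ℝ)..h₁, F₁ (Φ.flow s z))) ∂P ≤ K)
    (hΛ₂ : ∫⁻ z, ENNReal.ofReal (Real.exp (h₂⁻¹ * ∫ s in (0 : ℝ)..h₂, F₂ (Φ.flow s z))) ∂P ≤ K) :
    ∫⁻ z, ENNReal.ofReal (Real.exp (T⁻¹ * ∫ s in (0 : ℝ)..T, F (Φ.flow s z))) ∂P ≤
      K * ENNReal.ofReal (Real.exp (B * (h₁ + h₂) / (2 * T))) := by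
  have hT : 0 < T := hh₁.trans_le h₁T
  have e₁ := lintegral_exp_window_le_of_base Φ P hP hinv F₁ hB0 hB₁ hint₁ hY₁ hh₁ h₁T hK hΛ₁
  have e₂ := lintegral_exp_window_le_of_base Φ P hP hinv F₂ hB0 hB₂ hint₂ hY₂ hh₂ h₂T hK hΛ₂
  have hhalf : (0 : ℝ) ≤ 1 / 2 := by norm_num
  have hW₁m : AEMeasurable
      (fun z => ENNReal.ofReal (Real.exp (T⁻¹ * ∫ s in (0 : ℝ)..T, F₁ (Φ.flow s z)))) P :=
    ENNReal.measurable_ofReal.comp_aemeasurable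
      (Real.measurable_exp.comp_aemeasurable ((hY₁ T).const_mul _))
  have hW₂m : AEMeasurable
      (fun z => ENNReal.ofReal (Real.exp (T⁻¹ * ∫ s in (0 : ℝ)..T, F₂ (Φ.flow s z)))) P :=
    ENNReal.measurable_ofReal.comp_aemeasurable
      (Real.measurable_exp.comp_aemeasurable ((hY₂ T).const_mul _))
  have hFpt : ∀ w, F w = 1 / 2 * (F₁ w + F₂ w) := fun w => by
    have := hF w
    linarith
  have hae : ∀ᵐ z ∂P, z ∈ Φ.good := mem_ae_iff.mpr hP
  calc ∫⁻ z, ENNReal.ofReal (Real.exp (T⁻¹ * ∫ s in (0 : ℝ)..T, F (Φ.flow s z))) ∂P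
      = ∫⁻ z, ENNReal.ofReal (Real.exp (T⁻¹ * ∫ s in (0 : ℝ)..T, F₁ (Φ.flow s z))) ^ (1 / 2 : ℝ) *
          ENNReal.ofReal (Real.exp (T⁻¹ * ∫ s in (0 : ℝ)..T, F₂ (Φ.flow s z))) ^ (1 / 2 : ℝ) ∂P := by
        refine lintegral_congr_ae ?_
        filter_upwards [hae] with z hz
        rw [← ofReal_exp_mul_left _ _ hhalf, ← ofReal_exp_mul_left _ _ hhalf,
          ← ENNReal.ofReal_mul (Real.exp_pos _).le, ← Real.exp_add]
        congr 2
        simp_rw [hFpt]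
        rw [intervalIntegral.integral_const_mul,
          intervalIntegral.integral_add (hint₁ z hz 0 T) (hint₂ z hz 0 T)]
        ring
    _ ≤ (∫⁻ z, ENNReal.ofReal (Real.exp (T⁻¹ * ∫ s in (0 : ℝ)..T, F₁ (Φ.flow s z))) ∂P) ^ (1 / 2 : ℝ) *
          (∫⁻ z, ENNReal.ofReal (Real.exp (T⁻¹ * ∫ s in (0 : ℝ)..T, F₂ (Φ.flow s z))) ∂P) ^
            (1 / 2 : ℝ) :=
        ENNReal.lintegral_mul_norm_pow_le hW₁m hW₂m hhalf hhalf (add_halves 1)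
    _ ≤ (K * ENNReal.ofReal (Real.exp (B * (h₁ / T)))) ^ (1 / 2 : ℝ) *
          (K * ENNReal.ofReal (Real.exp (B * (h₂ / T)))) ^ (1 / 2 : ℝ) :=
        mul_le_mul' (ENNReal.rpow_le_rpow e₁ hhalf) (ENNReal.rpow_le_rpow e₂ hhalf)
    _ = K * ENNReal.ofReal (Real.exp (1 / 2 * (B * (h₁ / T)) + 1 / 2 * (B * (h₂ / T)))) := by
        rw [ENNReal.mul_rpow_of_nonneg _ _ hhalf, ENNReal.mul_rpow_of_nonneg _ _ hhalf, mul_mul_mul_comm,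
          ← ENNReal.rpow_add_of_nonneg _ _ hhalf hhalf, add_halves, ENNReal.rpow_one,
          ← ofReal_exp_mul_left _ _ hhalf, ← ofReal_exp_mul_left _ _ hhalf,
          ← ENNReal.ofReal_mul (Real.exp_pos _).le, ← Real.exp_add]
    _ = K * ENNReal.ofReal (Real.exp (B * (h₁ + h₂) / (2 * T))) := by
        congr 3
        field_simp

end Generic

/-- **Stub 3 — COMMON-WINDOW SUPERPOSITION (TRUE; size M; provable now from landed lemmas).** Fix `σ, a, θ > 0`, `u₀`,
`N`, a flow `Φ` and the (flow-invariant) global Gibbs law `G_N`, assumed a probability measure. For continuous `φ`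
(`|φ| ≤ 1`) and continuous velocity observables `G₁, G₂` with `|G₁|, |G₂| ≤ A` and `G₁ + G₂ = 2G`: if the
kinetic-window exponential moment of `(φ, G₁)` at window `τ₁` and that of `(φ, G₂)` at window `τ₂` are both `≤ K`
with `K ≥ 1`, then at every common window `τ ≥ τ₁, τ₂` the moment of `(φ, G)` is
`≤ K · exp(A (τ₁+τ₂)/(2τ) · (N+1))`. Proof: `Λ_τ(F_j) ≤ Λ_{m τ_j}(F_j)^{mτ_j/τ} · Λ_r(F_j)^{r/τ}` (two-window Hölder +
invariance, `τ = mτ_j + r`), `Λ_{mτ_j} ≤ Λ_{τ_j} ≤ K` (subadditivity), `Λ_r ≤ e^{A(N+1)}` (statics, `G_N` a probability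
law), so `Λ_τ(F_j) ≤ K e^{A(N+1)τ_j/τ}`; then Cauchy–Schwarz for `F = (F₁+F₂)/2`. Leans on (landed):
`KineticWindowGronwallWindowSubadditivity.lintegral_exp_window_mul_le`, `….lintegral_exp_window_add_le`,
`homogeneousInvariance_proof` (stmt-9621), `ENNReal.lintegral_mul_le_Lp_mul_Lq`,
`aemeasurable_window_of_modification`. [cite: KipnisLandim1999, Ch. 7 (subadditivity of window pressures); OllaVaradhanYau1993, §3] -/
theorem stub_windowSuperposition :
    ∀ (σ a θ : ℝ) (u₀ : V3), 0 < σ → 0 < a → 0 < θ → ∀ (N : ℕ)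
      (Φ : HardSphereFlow (Literature.Analysis.FluidPDE.Torus.geometry (Fin 3)) (hsDiameter σ N) (N + 1)),
      IsProbabilityMeasure (localGibbsLaw σ (fun _ => a) (fun _ => u₀) (fun _ => θ) N Φ) →
      ∀ (φ : T3 → ℝ) (G G₁ G₂ : V3 → ℝ) (A : ℝ), Continuous φ → Continuous G₁ → Continuous G₂ →
        (∀ x, |φ x| ≤ 1) → (∀ w, |G₁ w| ≤ A) → (∀ w, |G₂ w| ≤ A) → (∀ w, G₁ w + G₂ w = 2 * G w) →
        ∀ (K : ℝ≥0∞) (τ₁ τ₂ τ : ℝ), 0 < τ₁ → 0 < τ₂ → τ₁ ≤ τ → τ₂ ≤ τ → 1 ≤ K →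
          ∫⁻ z, ENNReal.ofReal (Real.exp ((τ₁ * ((N + 1 : ℕ) : ℝ) ^ (-(1 / 3 : ℝ)))⁻¹ *
              ∫ s in (0 : ℝ)..(τ₁ * ((N + 1 : ℕ) : ℝ) ^ (-(1 / 3 : ℝ))),
                ∑ i, φ (Φ.flow s z i).1 * G₁ ((Real.sqrt θ)⁻¹ • ((Φ.flow s z i).2 - u₀))))
            ∂(localGibbsLaw σ (fun _ => a) (fun _ => u₀) (fun _ => θ) N Φ) ≤ K →
          ∫⁻ z, ENNReal.ofReal (Real.exp ((τ₂ * ((N + 1 : ℕ) : ℝ) ^ (-(1 / 3 : ℝ)))⁻¹ *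
              ∫ s in (0 : ℝ)..(τ₂ * ((N + 1 : ℕ) : ℝ) ^ (-(1 / 3 : ℝ))),
                ∑ i, φ (Φ.flow s z i).1 * G₂ ((Real.sqrt θ)⁻¹ • ((Φ.flow s z i).2 - u₀))))
            ∂(localGibbsLaw σ (fun _ => a) (fun _ => u₀) (fun _ => θ) N Φ) ≤ K →
          ∫⁻ z, ENNReal.ofReal (Real.exp ((τ * ((N + 1 : ℕ) : ℝ) ^ (-(1 / 3 : ℝ)))⁻¹ *
              ∫ s in (0 : ℝ)..(τ * ((N + 1 : ℕ) : ℝ) ^ (-(1 / 3 : ℝ))),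
                ∑ i, φ (Φ.flow s z i).1 * G ((Real.sqrt θ)⁻¹ • ((Φ.flow s z i).2 - u₀))))
            ∂(localGibbsLaw σ (fun _ => a) (fun _ => u₀) (fun _ => θ) N Φ) ≤
            K * ENNReal.ofReal (Real.exp (A * (τ₁ + τ₂) / (2 * τ) * (N + 1))) := by
  intro σ a θ u₀ _hσ _ha _hθ N Φ hprob φ G G₁ G₂ A hφ hG₁ hG₂ hφ1 hG₁A hG₂A hsum K τ₁ τ₂ τ hτ₁ hτ₂ h₁τ h₂τ hK
    hΛ₁ hΛ₂
  classical
  haveI := hprob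
  set P := localGibbsLaw σ (fun _ => a) (fun _ => u₀) (fun _ => θ) N Φ with hPdef
  have hP : P Φ.goodᶜ = 0 :=
    mem_ae_iff.mp (Literature.MathematicalPhysics.KineticTheory.ae_mem_good_localGibbsLaw σ (fun _ => a)
      (fun _ => u₀) (fun _ => θ) N Φ)
  have hinv : ∀ t : ℝ, MeasurePreserving (Φ.flow t) P P :=
    Summit.AtomisticToContinuum.HydrodynamicLimit.Theorems.measurePreserving_flow_localGibbsLaw_const σ a θ u₀ N Φ
  -- the two one-body sums: measurable and bounded by `A (N + 1)`
  obtain ⟨hF₁m, hF₁b, -⟩ :=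
    KiferCompactification.stub_windowFunctional Φ θ u₀ φ G₁ A hφ hG₁ hφ1 hG₁A 1 one_pos
  obtain ⟨hF₂m, hF₂b, -⟩ :=
    KiferCompactification.stub_windowFunctional Φ θ u₀ φ G₂ A hφ hG₂ hφ1 hG₂A 1 one_pos
  have hA0 : 0 ≤ A := (abs_nonneg _).trans (hG₁A 0)
  have hB0 : 0 ≤ A * (N + 1) := by positivity
  -- pointwise superposition `F₁ + F₂ = 2 F`
  have hFsum : ∀ z : Config (N + 1) (Fin 3) T3,
      (∑ i, φ (z i).1 * G₁ ((Real.sqrt θ)⁻¹ • ((z i).2 - u₀))) +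
        (∑ i, φ (z i).1 * G₂ ((Real.sqrt θ)⁻¹ • ((z i).2 - u₀))) =
        2 * ∑ i, φ (z i).1 * G ((Real.sqrt θ)⁻¹ • ((z i).2 - u₀)) := fun z => by
    rw [← Finset.sum_add_distrib, Finset.mul_sum]
    refine Finset.sum_congr rfl fun i _ => ?_
    rw [← mul_add, hsum, mul_left_comm]
  -- interval integrability along good orbits and a.e.-measurability of the window functionals
  have hint₁ : ∀ z ∈ Φ.good, ∀ a b : ℝ, IntervalIntegrable
      (fun s => ∑ i, φ (Φ.flow s z i).1 * G₁ ((Real.sqrt θ)⁻¹ • ((Φ.flow s z i).2 - u₀))) volume a b :=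
    fun z hz a b => Φ.intervalIntegrable_comp_flow_of_bounded hz hF₁m hF₁b a b
  have hint₂ : ∀ z ∈ Φ.good, ∀ a b : ℝ, IntervalIntegrable
      (fun s => ∑ i, φ (Φ.flow s z i).1 * G₂ ((Real.sqrt θ)⁻¹ • ((Φ.flow s z i).2 - u₀))) volume a b :=
    fun z hz a b => Φ.intervalIntegrable_comp_flow_of_bounded hz hF₂m hF₂b a b
  have hY₁ : ∀ t : ℝ, AEMeasurable (fun z => ∫ s in (0 : ℝ)..t,
      ∑ i, φ (Φ.flow s z i).1 * G₁ ((Real.sqrt θ)⁻¹ • ((Φ.flow s z i).2 - u₀))) P := fun t =>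
    aemeasurable_window_of_modification Φ P hP
      (fun z => ∑ i, φ (z i).1 * G₁ ((Real.sqrt θ)⁻¹ • ((z i).2 - u₀)))
      (g := fun s z => ∑ i, φ (Φ.good.piecewise (Φ.flow s) id z i).1 *
        G₁ ((Real.sqrt θ)⁻¹ • ((Φ.good.piecewise (Φ.flow s) id z i).2 - u₀)))
      (hF₁m.comp (Literature.MathematicalPhysics.KineticTheory.measurable_piecewise_flow_torus Φ))
      (fun z hz s => by simp only [Set.piecewise_eq_of_mem _ _ _ hz]) 0 t
  have hY₂ : ∀ t : ℝ, AEMeasurable (fun z => ∫ s in (0 : ℝ)..t,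
      ∑ i, φ (Φ.flow s z i).1 * G₂ ((Real.sqrt θ)⁻¹ • ((Φ.flow s z i).2 - u₀))) P := fun t =>
    aemeasurable_window_of_modification Φ P hP
      (fun z => ∑ i, φ (z i).1 * G₂ ((Real.sqrt θ)⁻¹ • ((z i).2 - u₀)))
      (g := fun s z => ∑ i, φ (Φ.good.piecewise (Φ.flow s) id z i).1 *
        G₂ ((Real.sqrt θ)⁻¹ • ((Φ.good.piecewise (Φ.flow s) id z i).2 - u₀)))
      (hF₂m.comp (Literature.MathematicalPhysics.KineticTheory.measurable_piecewise_flow_torus Φ))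
      (fun z hz s => by simp only [Set.piecewise_eq_of_mem _ _ _ hz]) 0 t
  -- the kinetic length scale
  have hℓ : 0 < ((N + 1 : ℕ) : ℝ) ^ (-(1 / 3 : ℝ)) := Real.rpow_pos_of_pos (by positivity) _
  have hτ : 0 < τ := hτ₁.trans_le h₁τ
  generalize ((N + 1 : ℕ) : ℝ) ^ (-(1 / 3 : ℝ)) = ℓ at hℓ hΛ₁ hΛ₂ ⊢
  have key := lintegral_exp_window_superposition Φ P hP hinv
    (fun z => ∑ i, φ (z i).1 * G ((Real.sqrt θ)⁻¹ • ((z i).2 - u₀)))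
    (fun z => ∑ i, φ (z i).1 * G₁ ((Real.sqrt θ)⁻¹ • ((z i).2 - u₀)))
    (fun z => ∑ i, φ (z i).1 * G₂ ((Real.sqrt θ)⁻¹ • ((z i).2 - u₀)))
    hB0 hF₁b hF₂b hFsum hint₁ hint₂ hY₁ hY₂ (mul_pos hτ₁ hℓ) (mul_pos hτ₂ hℓ)
    (mul_le_mul_of_nonneg_right h₁τ hℓ.le) (mul_le_mul_of_nonneg_right h₂τ hℓ.le) hK hΛ₁ hΛ₂
  have hexp : A * (N + 1) * (τ₁ * ℓ + τ₂ * ℓ) / (2 * (τ * ℓ)) = A * (τ₁ + τ₂) / (2 * τ) * (N + 1) := by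
    field_simp
  rw [hexp] at key
  exact key

end Summit.AtomisticToContinuum.HydrodynamicLimit.Theorems.Birth

end
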